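/-
Copyright (c) 2026 the pub-hodgecm-mathlib formalisation cell (harness21).  Prover seat hodgecm-mathlib-A-p13 (g38), line LD1
(`Cruxes/HLiu418/Lines/F0_P6LD_StubS1FactsThetaRoad`, organ (L) «line pin», brick (L-T1)), 2026-09-02.  KERNEL module:
THEOREMS ONLY (no definition, no named fact, no instance, no notation, no `sorry`).
-/
import Literature.NumberTheory.GelbartRogawski1991.DoubledWeilRepresentationUniqueness
import Literature.NumberTheory.GelbartRogawski1991.DoubledWeilRepresentationDeltaFixingTransport
import Literature.NumberTheory.GelbartRogawski1991.DoubledWeilRepresentationUndoublingConj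
import Literature.NumberTheory.Automorphic.Liu2021.Def411WeilCarriersDoubling
import HarnessLib

-- buildfix G11b-3 recipe (as in the lineage `DoubledWeilRepresentationRelabel`): elaborate sequentially.
set_option Elab.async false

/-!
# The `χ`-attached doubled Weil representation depends on the frames `(d_V, d_W)` only through the Kronecker Gram `d_V ⊗ d_W`
# (brick (L-T1) of LD1 organ (L): the W-rescaling `(d_V, c•d_W) ≡ (c•d_V, d_W)` of the χ-splitting)

Topic `NumberTheory/GelbartRogawski1991`; namespace `Literature.NumberTheory.GelbartRogawski1991.GRConstruction`.  THEOREMS ONLY.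
Cell hodgecm-mathlib FLOOR 0, crux `HLiu418` (stmt-HodgeConjecture-24832), socket 27458 `F0_AlbCm.stub_S1_facts` (#73), LD1 in-house
θ-road, organ (L) `ThetaLinePinned₂` ([Liu2021, Thm. B.4 (2)]): after the local–global line pin `a″ = a′·N(b)` the seam must be moved from the
line `⟨a′·c⟩`, `c = N(b) ∈ L⁺`, to `⟨a′⟩`.  In the tree's currency the two index data `(d_V, a′·c)` and `(c•d_V, a′)` have THE SAME Kronecker
Gram matrix `d_V ⊗ (a′c) = (c•d_V) ⊗ a′` over `L⁺`, hence literally the same doubled symplectic space, the same doubled unitary group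
`H = U(J^𝔻)` as a matrix group, the same Siegel parabolic, the same `det_Δ`: every carrier of ★ `DoubledUnitaryGlobalSplittingData` reads
`(d_V, d_W)` only through `gramR = gram e (realDiagonal d_V) (realDiagonal d_W)`.  The `χ`-normalised doubled Weil representation
([GelbartRogawski1991, Prop. 3.1.1]; [Kudla1994, Thm. 3.1]) is UNIQUE (★ `isDoubledWeilRep_unique`), so it is the same homomorphism for
both index data — up to the identity retyping.  THIS FILE proves exactly that (no Weil theory beyond the tree's: a relabelling with `C = 1`).

Setting: two index data `(dV₁, dW₁)`, `(dV₂, dW₂)` of the same ranks `N, M` and enumeration `e`, with `hG : gramR[1] = gramR[2]`.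
* §0 the equal carriers: `gramD`, `gramDA`, `hermD` agree (`gramDA_eq_of_gramR_eq`, …); the relabelling `R := adelicMpContRelabel 1 _ :
  Mp(𝕎^𝔻[1])ᶜᵒⁿᵗ ≃* Mp(𝕎^𝔻[2])ᶜᵒⁿᵗ` has the SAME operators (★ `adelicMpCont.omega_relabel`).
* §1 bookkeeping for a retyping `θ : H[2](𝔸) →* H[1](𝔸)` that is the IDENTITY ON MATRICES (`hθ`): `blk`, `deltaBlock`, `det_Δ`, `P_Δ`,
  `χ(det_Δ ·)`, `|det_Δ ·|^{1/2}`, `ι^𝔻` do not move (pattern of ★ `DoubledWeilRepresentationRelabel` §1 with `conj` replaced by `id`).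
* §2 `relabel_rDelta_one`: `R (r_F^𝔻[1](δ)) = r_F^𝔻[2](δ)` (★ `adelicMpContRelabel_ratThetaLiftCont` at `C = 1`).
* §3 **`isDoubledWeilRep_relabel_comp_retype`**: `IsDoubledWeilRep[1] χ sD → IsDoubledWeilRep[2] χ (R ∘ sD ∘ θ)`;
  **`relabel_doubledWeilRep_comp_retype`**: `R ∘ doubledWeilRep[1] χ ∘ θ = doubledWeilRep[2] χ` (uniqueness).
* §4 (★ `omega_undoubleIdx_apply` of `DoubledWeilRepresentationUndoublingConj`) **`omega_undouble_eq_of_relabel_comp_retype`** / **`omega_chiSplitting_eq_of_gramR_eq`**: the UNDOUBLED Weil operators agree —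
  `ω(s_χ[1] (θ_pair g)) = ω(s_χ[2] g)` on `𝒮(𝔸^n)` (★ `omega_undouble_apply`: the undoubled operator is read off the doubled one on
  `Φ ⊠ testVec`, and `undoubleIdx = relabel₁ ∘ reindex_{e₂⁻¹}` has frame-independent operators).

HONEST SCOPE.  Nothing of [Liu2021] ∕ [GelbartRogawski1991] is asserted; no new letter.  The line-level packaging (the seam transport
(L-T1) for `MeetsThetaLiftFromLine`, via ★ `ThetaLiftFromLineSeamTransport`) is the sequel `Liu2021/ThetaLiftFromLineSeamRescale`.
HC_CM is proved only modulo the printed citations (2 remaining named inputs hLiu418 24832, h413 24833) until rung 0 closes; count-neutral.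

## References
* [GelbartRogawski1991] S. Gelbart, J. Rogawski, Invent. Math. 105 (1991), §3.1 Prop. 3.1.1 p. 455 L1–2, Remark p. 457; §3.2 p. 457.
* [Kudla1994] S. Kudla, Israel J. Math. 87 (1994), §2 (doubled space, Siegel parabolic), Thm. 3.1.
* [Weil1964] A. Weil, Acta Math. 111 (1964), Chap. III n° 40 p. 190, n° 41 Thm. 6 p. 193.
* [Liu2021] Y. Liu, Camb. J. Math. 9 (2021) = arXiv:2102.11518, App. D §D.1 Step 1 (footnote l. 5215); Thm. B.4 (2).
-/

set_option autoImplicit false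

noncomputable section

open scoped Classical
open scoped Matrix Kronecker
open NumberField IsDedekindDomain
open Literature.RepresentationTheory.HeisenbergGroup
open Literature.NumberTheory.Automorphic
open Literature.NumberTheory.Weil1964
open Literature.NumberTheory.GaloisRepresentations
open Literature.RepresentationTheory.HarrisKudlaSweet1996

namespace Literature.NumberTheory.GelbartRogawski1991.GRConstruction

open UnitaryDualPair DoubledWeilUniqueness
open Literature.NumberTheory.Automorphic.UnitaryGroup (symplecticGroupCongr coe_symplecticGroupCongr_apply)
open Literature.NumberTheory.Automorphic.Liu2021.Def411WeilCarriersDoubling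

variable (L : Type) [Field L] [NumberField L] [IsCMField L]
  {N M n : ℕ} (e : Fin N × Fin M ≃ Fin n)
  (dV₁ : Fin N → L) (hdV₁ : ∀ i, IsCMField.complexConj L (dV₁ i) = dV₁ i) (hdV₁0 : ∀ i, dV₁ i ≠ 0)
  (dW₁ : Fin M → L) (hdW₁ : ∀ i, IsCMField.complexConj L (dW₁ i) = dW₁ i) (hdW₁0 : ∀ i, dW₁ i ≠ 0)
  (dV₂ : Fin N → L) (hdV₂ : ∀ i, IsCMField.complexConj L (dV₂ i) = dV₂ i) (hdV₂0 : ∀ i, dV₂ i ≠ 0)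
  (dW₂ : Fin M → L) (hdW₂ : ∀ i, IsCMField.complexConj L (dW₂ i) = dW₂ i) (hdW₂0 : ∀ i, dW₂ i ≠ 0)

/-! ## §0 Equal Kronecker Gram data: the carriers coincide -/

section Carriers

variable {L e dV₁ hdV₁ dW₁ hdW₁ dV₂ hdV₂ dW₂ hdW₂}

/-- `T^𝔻[1] = T^𝔻[2]` from `gramR[1] = gramR[2]`. [cite: GelbartRogawski1991, §3.1 Prop. 3.1.1 p. 455 L1–2] -/
theorem gramD_eq_of_gramR_eq (hG : gramR L e dV₁ hdV₁ dW₁ hdW₁ = gramR L e dV₂ hdV₂ dW₂ hdW₂) :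
    gramD L e dV₁ hdV₁ dW₁ hdW₁ = gramD L e dV₂ hdV₂ dW₂ hdW₂ := by
  unfold gramD; rw [hG]

/-- `T^𝔻[1] ⊗ 1 = T^𝔻[2] ⊗ 1`. [cite: GelbartRogawski1991, §3.1 Prop. 3.1.1 p. 455 L1–2] -/
theorem gramDA_eq_of_gramR_eq (hG : gramR L e dV₁ hdV₁ dW₁ hdW₁ = gramR L e dV₂ hdV₂ dW₂ hdW₂) :
    gramDA L e dV₁ hdV₁ dW₁ hdW₁ = gramDA L e dV₂ hdV₂ dW₂ hdW₂ := by
  unfold gramDA; rw [gramD_eq_of_gramR_eq hG]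

/-- `J^𝔻[1] = J^𝔻[2]`. [cite: GelbartRogawski1991, §3.1 Prop. 3.1.1 p. 455 L1–2] -/
theorem hermD_eq_of_gramR_eq (hG : gramR L e dV₁ hdV₁ dW₁ hdW₁ = gramR L e dV₂ hdV₂ dW₂ hdW₂) :
    hermD L e dV₁ hdV₁ dW₁ hdW₁ = hermD L e dV₂ hdV₂ dW₂ hdW₂ := by
  unfold hermD; rw [gramD_eq_of_gramR_eq hG]

/-- `Tg[1] = Tg[2]` (the undoubled adelic Gram matrices). [cite: GelbartRogawski1991, §3.1 Prop. 3.1.1 p. 455 L1–2] -/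
theorem gramA_eq_of_gramR_eq (hG : gramR L e dV₁ hdV₁ dW₁ hdW₁ = gramR L e dV₂ hdV₂ dW₂ hdW₂) :
    gramA L e dV₁ hdV₁ dW₁ hdW₁ = gramA L e dV₂ hdV₂ dW₂ hdW₂ := by
  rw [gramA_eq_map, gramA_eq_map, hG]

/-- the relabelling identity with `C = 1`: `(T^𝔻[2] ⊗ 1) · 1 = T^𝔻[1] ⊗ 1`. [cite: GelbartRogawski1991, §3.1 p. 454] -/
theorem gramDA_mul_one_of_gramR_eq (hG : gramR L e dV₁ hdV₁ dW₁ hdW₁ = gramR L e dV₂ hdV₂ dW₂ hdW₂) :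
    gramDA L e dV₂ hdV₂ dW₂ hdW₂ *
        (((1 : GL (Fin (n + n)) (AdeleRing (𝓞 (Fp L)) (Fp L))) : GL (Fin (n + n)) (AdeleRing (𝓞 (Fp L)) (Fp L))) :
          Matrix (Fin (n + n)) (Fin (n + n)) (AdeleRing (𝓞 (Fp L)) (Fp L))) = gramDA L e dV₁ hdV₁ dW₁ hdW₁ := by
  rw [Units.val_one, Matrix.mul_one, gramDA_eq_of_gramR_eq hG]

/-- `H[2](𝔸) = H[1](𝔸)` as subgroups of `GL_{n+n}(𝔸_L)`. [cite: GelbartRogawski1991, §3.1 Prop. 3.1.1 p. 455 L1–2] -/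
theorem HA_eq_of_gramR_eq (hG : gramR L e dV₁ hdV₁ dW₁ hdW₁ = gramR L e dV₂ hdV₂ dW₂ hdW₂) :
    HA L e dV₂ hdV₂ dW₂ hdW₂ = HA L e dV₁ hdV₁ dW₁ hdW₁ := by
  show UnitaryGroup.adelic (Fp L) L (IsCMField.complexConj L) (n + n) (hermD L e dV₂ hdV₂ dW₂ hdW₂) =
    UnitaryGroup.adelic (Fp L) L (IsCMField.complexConj L) (n + n) (hermD L e dV₁ hdV₁ dW₁ hdW₁)
  rw [hermD_eq_of_gramR_eq hG]

end Carriers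

/-! ## §1 The Siegel parabolic, `det_Δ`, `χ(det_Δ ·)`, `|det_Δ ·|`, `ι^𝔻` under a retyping `θ` that is the identity on matrices -/

section Siegel

variable {L e dV₁ hdV₁ dW₁ hdW₁ dV₂ hdV₂ dW₂ hdW₂}
variable {θ : HA L e dV₂ hdV₂ dW₂ hdW₂ →* HA L e dV₁ hdV₁ dW₁ hdW₁}

/-- the block matrix does not move. [cite: Kudla1994, §2 (doubled space, Siegel parabolic)] -/
theorem blk_retype
    (hθ : ∀ h : HA L e dV₂ hdV₂ dW₂ hdW₂,
      ((θ h : HA L e dV₁ hdV₁ dW₁ hdW₁) : GL (Fin (n + n)) (AdeleRing (𝓞 L) L)) = (h : GL (Fin (n + n)) (AdeleRing (𝓞 L) L)))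
    (h : HA L e dV₂ hdV₂ dW₂ hdW₂) :
    blk L e dV₁ hdV₁ dW₁ hdW₁ (θ h) = blk L e dV₂ hdV₂ dW₂ hdW₂ h := by
  show Matrix.reindex _ _ _ = Matrix.reindex _ _ _
  rw [hθ]

/-- the `Δ`-block does not move. [cite: Kudla1994, §2 (doubled space, Siegel parabolic)] -/
theorem deltaBlock_retype
    (hθ : ∀ h : HA L e dV₂ hdV₂ dW₂ hdW₂,
      ((θ h : HA L e dV₁ hdV₁ dW₁ hdW₁) : GL (Fin (n + n)) (AdeleRing (𝓞 L) L)) = (h : GL (Fin (n + n)) (AdeleRing (𝓞 L) L)))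
    (h : HA L e dV₂ hdV₂ dW₂ hdW₂) :
    deltaBlock L e dV₁ hdV₁ dW₁ hdW₁ (θ h) = deltaBlock L e dV₂ hdV₂ dW₂ hdW₂ h := by
  rw [deltaBlock, deltaBlock, blk_retype hθ]

/-- **`det_Δ (θ h) = det_Δ h`**. [cite: Kudla1994, §2 (doubled space, Siegel parabolic)] -/
theorem detDelta_retype
    (hθ : ∀ h : HA L e dV₂ hdV₂ dW₂ hdW₂,
      ((θ h : HA L e dV₁ hdV₁ dW₁ hdW₁) : GL (Fin (n + n)) (AdeleRing (𝓞 L) L)) = (h : GL (Fin (n + n)) (AdeleRing (𝓞 L) L)))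
    (h : HA L e dV₂ hdV₂ dW₂ hdW₂) :
    detDelta L e dV₁ hdV₁ dW₁ hdW₁ (θ h) = detDelta L e dV₂ hdV₂ dW₂ hdW₂ h := by
  rw [detDelta, detDelta, deltaBlock_retype hθ]

/-- **`θ` preserves and reflects the Siegel parabolic `P_Δ`**. [cite: Kudla1994, §2 (doubled space, Siegel parabolic)] -/
theorem isSiegelDelta_retype_iff
    (hθ : ∀ h : HA L e dV₂ hdV₂ dW₂ hdW₂,
      ((θ h : HA L e dV₁ hdV₁ dW₁ hdW₁) : GL (Fin (n + n)) (AdeleRing (𝓞 L) L)) = (h : GL (Fin (n + n)) (AdeleRing (𝓞 L) L)))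
    (h : HA L e dV₂ hdV₂ dW₂ hdW₂) :
    IsSiegelDelta L e dV₁ hdV₁ dW₁ hdW₁ (θ h) ↔ IsSiegelDelta L e dV₂ hdV₂ dW₂ hdW₂ h := by
  unfold IsSiegelDelta
  rw [blk_retype hθ]

/-- `χ(det_Δ (θ p)) = χ(det_Δ p)`. [cite: GelbartRogawski1991, §3.1 Prop. 3.1.1 p. 455 L1–2] [cite: HarrisKudlaSweet1996, §1 (1.14)–(1.15)] -/
theorem chiDet_retype
    (hθ : ∀ h : HA L e dV₂ hdV₂ dW₂ hdW₂,
      ((θ h : HA L e dV₁ hdV₁ dW₁ hdW₁) : GL (Fin (n + n)) (AdeleRing (𝓞 L) L)) = (h : GL (Fin (n + n)) (AdeleRing (𝓞 L) L)))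
    (χ : HeckeCharacter L) (p : HA L e dV₂ hdV₂ dW₂ hdW₂) :
    chiDet L e dV₁ hdV₁ dW₁ hdW₁ χ (θ p) = chiDet L e dV₂ hdV₂ dW₂ hdW₂ χ p := by
  unfold chiDet
  by_cases hu : IsUnit (detDelta L e dV₂ hdV₂ dW₂ hdW₂ p)
  · have hu' : IsUnit (detDelta L e dV₁ hdV₁ dW₁ hdW₁ (θ p)) := by rwa [detDelta_retype hθ]
    rw [dif_pos hu', dif_pos hu]
    have e1 : hu'.unit = hu.unit := Units.ext (by rw [IsUnit.unit_spec, IsUnit.unit_spec, detDelta_retype hθ])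
    rw [e1]
  · have hu' : ¬ IsUnit (detDelta L e dV₁ hdV₁ dW₁ hdW₁ (θ p)) := by rwa [detDelta_retype hθ]
    rw [dif_neg hu', dif_neg hu]

/-- `|det_Δ (θ p)|^{1/2} = |det_Δ p|^{1/2}`. [cite: GelbartRogawski1991, §3.1 Prop. 3.1.1 p. 455 L1–2] -/
theorem modDelta_retype
    (hθ : ∀ h : HA L e dV₂ hdV₂ dW₂ hdW₂,
      ((θ h : HA L e dV₁ hdV₁ dW₁ hdW₁) : GL (Fin (n + n)) (AdeleRing (𝓞 L) L)) = (h : GL (Fin (n + n)) (AdeleRing (𝓞 L) L)))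
    (p : HA L e dV₂ hdV₂ dW₂ hdW₂) :
    modDelta L e dV₁ hdV₁ dW₁ hdW₁ (θ p) = modDelta L e dV₂ hdV₂ dW₂ hdW₂ p := by
  unfold modDelta
  by_cases hu : IsUnit (detDelta L e dV₂ hdV₂ dW₂ hdW₂ p)
  · have hu' : IsUnit (detDelta L e dV₁ hdV₁ dW₁ hdW₁ (θ p)) := by rwa [detDelta_retype hθ]
    rw [dif_pos hu', dif_pos hu]
    have e1 : hu'.unit = hu.unit := Units.ext (by rw [IsUnit.unit_spec, IsUnit.unit_spec, detDelta_retype hθ])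
    rw [e1]
  · have hu' : ¬ IsUnit (detDelta L e dV₁ hdV₁ dW₁ hdW₁ (θ p)) := by rwa [detDelta_retype hθ]
    rw [dif_neg hu', dif_neg hu]

/-- **`ι^𝔻` does not move**: `Λ₁ ι^𝔻[1](θ h) Λ₁⁻¹ = ι^𝔻[2](h)` along the relabelling with `C = 1` (both are the restriction of
scalars of the matrix `h`). [cite: Kudla1984, §1] [cite: MoeglinVignerasWaldspurger1987, Chap. 2 II.1 (A)] -/
theorem symplecticGroupCongr_one_toSpD_retype
    (hC : gramDA L e dV₂ hdV₂ dW₂ hdW₂ *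
        (((1 : GL (Fin (n + n)) (AdeleRing (𝓞 (Fp L)) (Fp L))) : GL (Fin (n + n)) (AdeleRing (𝓞 (Fp L)) (Fp L))) :
          Matrix (Fin (n + n)) (Fin (n + n)) (AdeleRing (𝓞 (Fp L)) (Fp L))) = gramDA L e dV₁ hdV₁ dW₁ hdW₁)
    (hθ : ∀ h : HA L e dV₂ hdV₂ dW₂ hdW₂,
      ((θ h : HA L e dV₁ hdV₁ dW₁ hdW₁) : GL (Fin (n + n)) (AdeleRing (𝓞 L) L)) = (h : GL (Fin (n + n)) (AdeleRing (𝓞 L) L)))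
    (h : HA L e dV₂ hdV₂ dW₂ hdW₂) :
    symplecticGroupCongr _ _ (relabelVec (Fp L) (Fin (n + n)) 1) (polar_relabelVec (Fp L) (Fin (n + n)) 1 hC)
        (toSpD L e dV₁ hdV₁ dW₁ hdW₁ (θ h)) = toSpD L e dV₂ hdV₂ dW₂ hdW₂ h := by
  refine Subtype.ext (LinearEquiv.ext fun v => ?_)
  rw [coe_symplecticGroupCongr_apply, coe_toSpD, coe_toSpD, hθ]
  simp only [relabelVec_symm_apply, relabelVec_apply, inv_one, Units.val_one, Matrix.one_mulVec, Prod.mk.eta]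

end Siegel

/-! ## §2 Weil's rational element `r_F^𝔻(δ)` under the relabelling with `C = 1` -/

section Delta

variable {L e dV₁ hdV₁ dW₁ hdW₁ dV₂ hdV₂ dW₂ hdW₂}

/-- **`R (r_F^𝔻[1](δ)) = r_F^𝔻[2](δ)`** along `R = adelicMpContRelabel 1 hC` (★ `adelicMpContRelabel_ratThetaLiftCont`: the rational
matrix `deltaD` is the same; Θ-rigidity). [cite: Weil1964, Chap. III n° 40 p. 190, n° 41 Thm 6 p. 193] [cite: GelbartRogawski1991, §3.1 Prop. 3.1.1 p. 455 L1–2] -/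
theorem relabel_rDelta_one
    (hC : gramDA L e dV₂ hdV₂ dW₂ hdW₂ *
        (((1 : GL (Fin (n + n)) (AdeleRing (𝓞 (Fp L)) (Fp L))) : GL (Fin (n + n)) (AdeleRing (𝓞 (Fp L)) (Fp L))) :
          Matrix (Fin (n + n)) (Fin (n + n)) (AdeleRing (𝓞 (Fp L)) (Fp L))) = gramDA L e dV₁ hdV₁ dW₁ hdW₁) :
    adelicMpContRelabel (Fp L) (Fin (n + n)) 1 hC (rDelta L e dV₁ hdV₁ hdV₁0 dW₁ hdW₁ hdW₁0) =
      rDelta L e dV₂ hdV₂ hdV₂0 dW₂ hdW₂ hdW₂0 :=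
  adelicMpContRelabel_ratThetaLiftCont (Fp L) (gramDA L e dV₂ hdV₂ dW₂ hdW₂) (isUnit_det_gramDA L e dV₂ hdV₂ hdV₂0 dW₂ hdW₂ hdW₂0)
    1 hC (isUnit_det_gramDA L e dV₁ hdV₁ hdV₁0 dW₁ hdW₁ hdW₁0) (deltaD L)

end Delta

/-! ## §3 THE TRANSPORT `IsDoubledWeilRep[1] χ sD → IsDoubledWeilRep[2] χ (R ∘ sD ∘ θ)` and the identification by uniqueness -/

/-- group bookkeeping: `r′ · R x · r′⁻¹ = R (r · x · r⁻¹)` when `R r = r′`. [folklore] -/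
private theorem conj_eq_map_conj' {G H : Type*} [Group G] [Group H] (R : G ≃* H) (r : G) {r' : H} (hr : R r = r') (x : G) :
    r' * R x * r'⁻¹ = R (r * x * r⁻¹) := by
  subst hr
  rw [map_mul, map_mul, map_inv]

section Transport

variable {L e dV₁ hdV₁ dW₁ hdW₁ dV₂ hdV₂ dW₂ hdW₂}

set_option maxHeartbeats 1600000 in
-- (the `IsDoubledWeilRep` telescopes of BOTH index data are compared in `isDefEq`; budget of ★ `DoubledWeilRepresentationRelabel` §3)
/-- **THE `χ`-NORMALISED DOUBLED WEIL REPRESENTATION TRANSPORTS ALONG EQUAL KRONECKER GRAM DATA.**  For `sD : H[1](𝔸) →* Mp(𝕎^𝔻[1])ᶜᵒⁿᵗ`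
`χ`-normalised, a continuous retyping `θ : H[2](𝔸) →* H[1](𝔸)` that is the identity on matrices (`hθ`), and the relabelling
`R = adelicMpContRelabel 1 hC : Mp(𝕎^𝔻[1])ᶜᵒⁿᵗ ≃* Mp(𝕎^𝔻[2])ᶜᵒⁿᵗ` (`hC : (T^𝔻[2] ⊗ 1)·1 = T^𝔻[1] ⊗ 1`): `R ∘ sD ∘ θ` is `χ`-normalised for
the index data `[2]` — continuous; over `ι^𝔻[2]` (§1); and on `P_Δ[2](𝔸)` the operator of `r[2](δ) · R(sD(θ p)) · r[2](δ)⁻¹ =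
R (r[1](δ) sD(θ p) r[1](δ)⁻¹)` (§2) IS that of `r[1](δ) sD(θ p) r[1](δ)⁻¹` (★ `adelicMpCont.omega_relabel`), whose value at the origin is
`χ(det_Δ p) |det_Δ p|^{1/2} Φ(0)` (§1). [cite: GelbartRogawski1991, §3.1 Prop. 3.1.1 p. 455 L1–2, Remark p. 457 L4–13]
[cite: HarrisKudlaSweet1996, §1 (1.14)–(1.15)] [cite: Kudla1994, §3 Thm. 3.1] -/
theorem isDoubledWeilRep_relabel_comp_retype
    (hC : gramDA L e dV₂ hdV₂ dW₂ hdW₂ *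
        (((1 : GL (Fin (n + n)) (AdeleRing (𝓞 (Fp L)) (Fp L))) : GL (Fin (n + n)) (AdeleRing (𝓞 (Fp L)) (Fp L))) :
          Matrix (Fin (n + n)) (Fin (n + n)) (AdeleRing (𝓞 (Fp L)) (Fp L))) = gramDA L e dV₁ hdV₁ dW₁ hdW₁)
    {θ : HA L e dV₂ hdV₂ dW₂ hdW₂ →* HA L e dV₁ hdV₁ dW₁ hdW₁}
    (hθ : ∀ h : HA L e dV₂ hdV₂ dW₂ hdW₂,
      ((θ h : HA L e dV₁ hdV₁ dW₁ hdW₁) : GL (Fin (n + n)) (AdeleRing (𝓞 L) L)) = (h : GL (Fin (n + n)) (AdeleRing (𝓞 L) L)))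
    (hθc : Continuous θ)
    (χ : HeckeCharacter L) {sD : HA L e dV₁ hdV₁ dW₁ hdW₁ →* MpD L e dV₁ hdV₁ dW₁ hdW₁}
    (hsD : IsDoubledWeilRep L e dV₁ hdV₁ hdV₁0 dW₁ hdW₁ hdW₁0 χ sD) (hdV₂0 : ∀ i, dV₂ i ≠ 0) (hdW₂0 : ∀ i, dW₂ i ≠ 0) :
    IsDoubledWeilRep L e dV₂ hdV₂ hdV₂0 dW₂ hdW₂ hdW₂0 χ
      (((adelicMpContRelabel (Fp L) (Fin (n + n)) 1 hC).toMonoidHom.comp sD).comp θ) := by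
  refine ⟨?_, fun h => ?_, fun p hp hu Φ => ?_⟩
  · exact (continuous_adelicMpContRelabel (Fp L) (Fin (n + n)) 1 hC).comp (hsD.continuous.comp hθc)
  · rw [MonoidHom.comp_apply, MonoidHom.comp_apply]
    have e1 : projD L e dV₂ hdV₂ dW₂ hdW₂ ((adelicMpContRelabel (Fp L) (Fin (n + n)) 1 hC).toMonoidHom (sD (θ h))) =
        symplecticGroupCongr _ _ (relabelVec (Fp L) (Fin (n + n)) 1) (polar_relabelVec (Fp L) (Fin (n + n)) 1 hC)
          (projD L e dV₁ hdV₁ dW₁ hdW₁ (sD (θ h))) :=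
      adelicMpCont.proj_relabel (Fp L) (Fin (n + n)) 1 hC (sD (θ h))
    rw [e1, hsD.proj_eq (θ h), symplecticGroupCongr_one_toSpD_retype hC hθ h]
  · have hp' : IsSiegelDelta L e dV₁ hdV₁ dW₁ hdW₁ (θ p) := (isSiegelDelta_retype_iff hθ p).2 hp
    have hu' : IsUnit (detDelta L e dV₁ hdV₁ dW₁ hdW₁ (θ p)) := by rwa [detDelta_retype hθ]
    have key := hsD.parabolic (θ p) hp' hu' Φ
    have e1 : rDelta L e dV₂ hdV₂ hdV₂0 dW₂ hdW₂ hdW₂0 *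
            (((adelicMpContRelabel (Fp L) (Fin (n + n)) 1 hC).toMonoidHom.comp sD).comp θ) p *
          (rDelta L e dV₂ hdV₂ hdV₂0 dW₂ hdW₂ hdW₂0)⁻¹ =
        adelicMpContRelabel (Fp L) (Fin (n + n)) 1 hC
          (rDelta L e dV₁ hdV₁ hdV₁0 dW₁ hdW₁ hdW₁0 * sD (θ p) * (rDelta L e dV₁ hdV₁ hdV₁0 dW₁ hdW₁ hdW₁0)⁻¹) :=
      conj_eq_map_conj' (adelicMpContRelabel (Fp L) (Fin (n + n)) 1 hC) (rDelta L e dV₁ hdV₁ hdV₁0 dW₁ hdW₁ hdW₁0)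
        (relabel_rDelta_one (hdV₁0 := hdV₁0) (hdW₁0 := hdW₁0) (hdV₂0 := hdV₂0) (hdW₂0 := hdW₂0) hC) (sD (θ p))
    have e2 : ∀ m : MpD L e dV₁ hdV₁ dW₁ hdW₁,
        opD L e dV₂ hdV₂ dW₂ hdW₂ (adelicMpContRelabel (Fp L) (Fin (n + n)) 1 hC m) Φ = opD L e dV₁ hdV₁ dW₁ hdW₁ m Φ := fun m =>
      congrArg (fun T : Module.End ℂ (piSchwartzBruhat (Fp L) (Fin (n + n))) =>
        ((T Φ : piSchwartzBruhat (Fp L) (Fin (n + n))) : (Fin (n + n) → AdeleRing (𝓞 (Fp L)) (Fp L)) → ℂ))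
        (adelicMpCont.omega_relabel (Fp L) (Fin (n + n)) 1 hC m)
    rw [e1, e2, key, chiDet_retype hθ, modDelta_retype hθ]

set_option maxHeartbeats 1600000 in
-- (same telescope budget)
/-- **`R ∘ doubledWeilRep[1] χ ∘ θ = doubledWeilRep[2] χ`** — by the uniqueness of the `χ`-normalised doubled Weil representation
(★ `isDoubledWeilRep_unique`) at the index data `[2]`. [cite: GelbartRogawski1991, §3.1 Prop. 3.1.1 p. 455 L1–2] [cite: Kudla1994, §3 Thm. 3.1] -/
theorem relabel_doubledWeilRep_comp_retype
    (hC : gramDA L e dV₂ hdV₂ dW₂ hdW₂ *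
        (((1 : GL (Fin (n + n)) (AdeleRing (𝓞 (Fp L)) (Fp L))) : GL (Fin (n + n)) (AdeleRing (𝓞 (Fp L)) (Fp L))) :
          Matrix (Fin (n + n)) (Fin (n + n)) (AdeleRing (𝓞 (Fp L)) (Fp L))) = gramDA L e dV₁ hdV₁ dW₁ hdW₁)
    {θ : HA L e dV₂ hdV₂ dW₂ hdW₂ →* HA L e dV₁ hdV₁ dW₁ hdW₁}
    (hθ : ∀ h : HA L e dV₂ hdV₂ dW₂ hdW₂,
      ((θ h : HA L e dV₁ hdV₁ dW₁ hdW₁) : GL (Fin (n + n)) (AdeleRing (𝓞 L) L)) = (h : GL (Fin (n + n)) (AdeleRing (𝓞 L) L)))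
    (hθc : Continuous θ) (χ : HeckeCharacter L) (hχu : χ.IsUnitary) (hχs : IsSplittingChar L 1 χ)
    (hdV₁0 : ∀ i, dV₁ i ≠ 0) (hdW₁0 : ∀ i, dW₁ i ≠ 0) (hdV₂0 : ∀ i, dV₂ i ≠ 0) (hdW₂0 : ∀ i, dW₂ i ≠ 0) :
    ((adelicMpContRelabel (Fp L) (Fin (n + n)) 1 hC).toMonoidHom.comp
        (doubledWeilRep L e dV₁ hdV₁ hdV₁0 dW₁ hdW₁ hdW₁0 χ hχu hχs)).comp θ =
      doubledWeilRep L e dV₂ hdV₂ hdV₂0 dW₂ hdW₂ hdW₂0 χ hχu hχs :=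
  isDoubledWeilRep_unique L e dV₂ hdV₂ hdV₂0 dW₂ hdW₂ hdW₂0 χ
    (isDoubledWeilRep_relabel_comp_retype (hdV₁0 := hdV₁0) (hdW₁0 := hdW₁0) hC hθ hθc χ
      (isDoubledWeilRep_doubledWeilRep L e dV₁ hdV₁ hdV₁0 dW₁ hdW₁ hdW₁0 χ hχu hχs) hdV₂0 hdW₂0)
    (isDoubledWeilRep_doubledWeilRep L e dV₂ hdV₂ hdV₂0 dW₂ hdW₂ hdW₂0 χ hχu hχs)

end Transport

/-! ## §4 The UNDOUBLED Weil operators agree: `ω(s_χ[1](θ_pair g)) = ω(s_χ[2](g))` -/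

section Undouble

variable {L e dV₁ hdV₁ dW₁ hdW₁ dV₂ hdV₂ dW₂ hdW₂}

/-- the retypings are compatible with `g ↦ g ⊕ 1`: `θ (inlG[2] g) = inlG[1] (θ_pair g)` (same matrices).
[cite: Kudla1994, §2 (doubled space, Siegel parabolic), Thm. 3.1] -/
theorem retype_inlG
    {θ : HA L e dV₂ hdV₂ dW₂ hdW₂ →* HA L e dV₁ hdV₁ dW₁ hdW₁}
    (hθ : ∀ h : HA L e dV₂ hdV₂ dW₂ hdW₂,
      ((θ h : HA L e dV₁ hdV₁ dW₁ hdW₁) : GL (Fin (n + n)) (AdeleRing (𝓞 L) L)) = (h : GL (Fin (n + n)) (AdeleRing (𝓞 L) L)))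
    {θG : UnitaryGroup.adelicPair (Fp L) L (IsCMField.complexConj L) N M (Matrix.diagonal dV₂) (Matrix.diagonal dW₂) →*
      UnitaryGroup.adelicPair (Fp L) L (IsCMField.complexConj L) N M (Matrix.diagonal dV₁) (Matrix.diagonal dW₁)}
    (hθG : ∀ g, ((θG g : UnitaryGroup.adelicPair (Fp L) L (IsCMField.complexConj L) N M (Matrix.diagonal dV₁) (Matrix.diagonal dW₁)) :
      GL (Fin N × Fin M) (AdeleRing (𝓞 L) L)) = (g : GL (Fin N × Fin M) (AdeleRing (𝓞 L) L)))
    (g : UnitaryGroup.adelicPair (Fp L) L (IsCMField.complexConj L) N M (Matrix.diagonal dV₂) (Matrix.diagonal dW₂)) :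
    θ (inlG L e dV₂ hdV₂ dW₂ hdW₂ g) = inlG L e dV₁ hdV₁ dW₁ hdW₁ (θG g) :=
  Subtype.ext ((hθ _).trans (by rw [coe_inlG, coe_inlG, hθG]))

set_option maxHeartbeats 1600000 in
-- (telescopes of both index data)
/-- **THE UNDOUBLED OPERATORS AGREE.**  If `sD₂ = R ∘ sD₁ ∘ θ` pointwise (R the relabelling with `C = 1`, `θ`, `θ_pair` the retypings,
identity on matrices), then for every `g ∈ U(J_V[2] ⊗ J_W[2])(𝔸)` the undoubled elements `s[1](θ_pair g) ∈ Mp(𝕎[1])`, `s[2](g) ∈ Mp(𝕎[2])`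
have THE SAME Weil operator on `𝒮(𝔸^n)` — both are read off the doubled operator on `Φ ⊠ testVec` (★ `omega_undouble_apply`), and the
doubled operators agree (`undoubleIdx` = relabel ∘ reindex, ★ `omega_relabel`, ★ `omega_reindex_apply`).
[cite: Kudla1994, §2 (doubled space, Siegel parabolic), Thm. 3.1] [cite: GelbartRogawski1991, §3.2 p. 457] -/
theorem omega_undouble_eq_of_relabel_comp_retype
    (hC : gramDA L e dV₂ hdV₂ dW₂ hdW₂ *
        (((1 : GL (Fin (n + n)) (AdeleRing (𝓞 (Fp L)) (Fp L))) : GL (Fin (n + n)) (AdeleRing (𝓞 (Fp L)) (Fp L))) :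
          Matrix (Fin (n + n)) (Fin (n + n)) (AdeleRing (𝓞 (Fp L)) (Fp L))) = gramDA L e dV₁ hdV₁ dW₁ hdW₁)
    {θ : HA L e dV₂ hdV₂ dW₂ hdW₂ →* HA L e dV₁ hdV₁ dW₁ hdW₁}
    (hθ : ∀ h : HA L e dV₂ hdV₂ dW₂ hdW₂,
      ((θ h : HA L e dV₁ hdV₁ dW₁ hdW₁) : GL (Fin (n + n)) (AdeleRing (𝓞 L) L)) = (h : GL (Fin (n + n)) (AdeleRing (𝓞 L) L)))
    {θG : UnitaryGroup.adelicPair (Fp L) L (IsCMField.complexConj L) N M (Matrix.diagonal dV₂) (Matrix.diagonal dW₂) →*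
      UnitaryGroup.adelicPair (Fp L) L (IsCMField.complexConj L) N M (Matrix.diagonal dV₁) (Matrix.diagonal dW₁)}
    (hθG : ∀ g, ((θG g : UnitaryGroup.adelicPair (Fp L) L (IsCMField.complexConj L) N M (Matrix.diagonal dV₁) (Matrix.diagonal dW₁)) :
      GL (Fin N × Fin M) (AdeleRing (𝓞 L) L)) = (g : GL (Fin N × Fin M) (AdeleRing (𝓞 L) L)))
    {sD₁ : HA L e dV₁ hdV₁ dW₁ hdW₁ →* MpD L e dV₁ hdV₁ dW₁ hdW₁}
    (hproj₁ : ∀ h, projD L e dV₁ hdV₁ dW₁ hdW₁ (sD₁ h) = toSpD L e dV₁ hdV₁ dW₁ hdW₁ h)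
    {sD₂ : HA L e dV₂ hdV₂ dW₂ hdW₂ →* MpD L e dV₂ hdV₂ dW₂ hdW₂}
    (hproj₂ : ∀ h, projD L e dV₂ hdV₂ dW₂ hdW₂ (sD₂ h) = toSpD L e dV₂ hdV₂ dW₂ hdW₂ h)
    (hrel : ∀ h, sD₂ h = adelicMpContRelabel (Fp L) (Fin (n + n)) 1 hC (sD₁ (θ h)))
    (g : UnitaryGroup.adelicPair (Fp L) L (IsCMField.complexConj L) N M (Matrix.diagonal dV₂) (Matrix.diagonal dW₂))
    (Φ : piSchwartzBruhat (Fp L) (Fin n)) :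
    adelicMpCont.omega (Fp L) (Fin n) (gramA L e dV₁ hdV₁ dW₁ hdW₁) (undouble L e dV₁ hdV₁ hdV₁0 dW₁ hdW₁ hdW₁0 hproj₁ (θG g)) Φ =
      adelicMpCont.omega (Fp L) (Fin n) (gramA L e dV₂ hdV₂ dW₂ hdW₂) (undouble L e dV₂ hdV₂ hdV₂0 dW₂ hdW₂ hdW₂0 hproj₂ g) Φ := by
  -- the doubled operators on `Fin n ⊕ Fin n` agree
  have hU : ∀ Ψ : piSchwartzBruhat (Fp L) (Fin n ⊕ Fin n),
      adelicMpCont.omega (Fp L) (Fin n ⊕ Fin n) (gramS L e dV₂ hdV₂ dW₂ hdW₂) (uD L e dV₂ hdV₂ dW₂ hdW₂ sD₂ g) Ψ =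
        adelicMpCont.omega (Fp L) (Fin n ⊕ Fin n) (gramS L e dV₁ hdV₁ dW₁ hdW₁) (uD L e dV₁ hdV₁ dW₁ hdW₁ sD₁ (θG g)) Ψ := fun Ψ => by
    -- the doubled elements have the same operator on `Fin (n + n)`
    have hBD : adelicMpCont.omega (Fp L) (Fin (n + n)) (gramDA L e dV₂ hdV₂ dW₂ hdW₂) (sD₂ (inlG L e dV₂ hdV₂ dW₂ hdW₂ g)) =
        adelicMpCont.omega (Fp L) (Fin (n + n)) (gramDA L e dV₁ hdV₁ dW₁ hdW₁) (sD₁ (inlG L e dV₁ hdV₁ dW₁ hdW₁ (θG g))) :=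
      ((congrArg (adelicMpCont.omega (Fp L) (Fin (n + n)) (gramDA L e dV₂ hdV₂ dW₂ hdW₂)) (hrel _)).trans
        (adelicMpCont.omega_relabel (Fp L) (Fin (n + n)) 1 hC (sD₁ (θ (inlG L e dV₂ hdV₂ dW₂ hdW₂ g))))).trans
        (congrArg (fun h => adelicMpCont.omega (Fp L) (Fin (n + n)) (gramDA L e dV₁ hdV₁ dW₁ hdW₁) (sD₁ h)) (retype_inlG hθ hθG g))
    exact ((omega_undoubleIdx_apply (L := L) (e := e) (dV := dV₂) (hdV := hdV₂) dW₂ hdW₂ (sD₂ (inlG L e dV₂ hdV₂ dW₂ hdW₂ g)) Ψ).trans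
      (congrArg (fun T : Module.End ℂ (piSchwartzBruhat (Fp L) (Fin (n + n))) =>
        piSBReindex (Fp L) (e₂ (n := n)).symm (T ((piSBReindex (Fp L) (e₂ (n := n)).symm).symm Ψ))) hBD)).trans
      (omega_undoubleIdx_apply (L := L) (e := e) (dV := dV₁) (hdV := hdV₁) dW₁ hdW₁ (sD₁ (inlG L e dV₁ hdV₁ dW₁ hdW₁ (θG g))) Ψ).symm
  refine Subtype.ext (funext fun x => ?_)
  exact (omega_undouble_apply L e dV₁ hdV₁ hdV₁0 dW₁ hdW₁ hdW₁0 hproj₁ (θG g) Φ x).trans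
    ((congrArg (fun Ψ : piSchwartzBruhat (Fp L) (Fin n ⊕ Fin n) => (Ψ : (Fin n ⊕ Fin n → AdeleRing (𝓞 (Fp L)) (Fp L)) → ℂ) (Sum.elim x 0))
      (hU (tensorToSum (Fp L) (Fin n) (Fin n) Φ (testVec L))).symm).trans
      (omega_undouble_apply L e dV₂ hdV₂ hdV₂0 dW₂ hdW₂ hdW₂0 hproj₂ g Φ x).symm)

set_option maxHeartbeats 1600000 in
-- (telescopes of both index data)
/-- **THE `χ`-SPLITTINGS OF TWO INDEX DATA WITH THE SAME KRONECKER GRAM HAVE THE SAME WEIL OPERATORS**: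
`ω(s_χ[1](θ_pair g)) = ω(s_χ[2](g))` on `𝒮(𝔸^n)` (`s_χ = undoubleHom (doubledWeilRep χ)`, §3 + the previous theorem).
[cite: GelbartRogawski1991, §3.1 Prop. 3.1.1 p. 455 L1–2; §3.2 p. 457] [cite: Kudla1994, §3 Thm. 3.1]
[cite: Liu2021, App. D §D.1 Step 1 (footnote l. 5215)] -/
theorem omega_chiSplitting_eq_of_gramDA_eq
    (hC : gramDA L e dV₂ hdV₂ dW₂ hdW₂ *
        (((1 : GL (Fin (n + n)) (AdeleRing (𝓞 (Fp L)) (Fp L))) : GL (Fin (n + n)) (AdeleRing (𝓞 (Fp L)) (Fp L))) :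
          Matrix (Fin (n + n)) (Fin (n + n)) (AdeleRing (𝓞 (Fp L)) (Fp L))) = gramDA L e dV₁ hdV₁ dW₁ hdW₁)
    {θ : HA L e dV₂ hdV₂ dW₂ hdW₂ →* HA L e dV₁ hdV₁ dW₁ hdW₁}
    (hθ : ∀ h : HA L e dV₂ hdV₂ dW₂ hdW₂,
      ((θ h : HA L e dV₁ hdV₁ dW₁ hdW₁) : GL (Fin (n + n)) (AdeleRing (𝓞 L) L)) = (h : GL (Fin (n + n)) (AdeleRing (𝓞 L) L)))
    (hθc : Continuous θ)
    {θG : UnitaryGroup.adelicPair (Fp L) L (IsCMField.complexConj L) N M (Matrix.diagonal dV₂) (Matrix.diagonal dW₂) →*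
      UnitaryGroup.adelicPair (Fp L) L (IsCMField.complexConj L) N M (Matrix.diagonal dV₁) (Matrix.diagonal dW₁)}
    (hθG : ∀ g, ((θG g : UnitaryGroup.adelicPair (Fp L) L (IsCMField.complexConj L) N M (Matrix.diagonal dV₁) (Matrix.diagonal dW₁)) :
      GL (Fin N × Fin M) (AdeleRing (𝓞 L) L)) = (g : GL (Fin N × Fin M) (AdeleRing (𝓞 L) L)))
    (χ : HeckeCharacter L) (hχu : χ.IsUnitary) (hχs : IsSplittingChar L 1 χ)
    (g : UnitaryGroup.adelicPair (Fp L) L (IsCMField.complexConj L) N M (Matrix.diagonal dV₂) (Matrix.diagonal dW₂))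
    (Φ : piSchwartzBruhat (Fp L) (Fin n)) :
    adelicMpCont.omega (Fp L) (Fin n) (gramA L e dV₁ hdV₁ dW₁ hdW₁)
        (chiSplitting L e dV₁ hdV₁ hdV₁0 dW₁ hdW₁ hdW₁0 χ hχu hχs (θG g)) Φ =
      adelicMpCont.omega (Fp L) (Fin n) (gramA L e dV₂ hdV₂ dW₂ hdW₂)
        (chiSplitting L e dV₂ hdV₂ hdV₂0 dW₂ hdW₂ hdW₂0 χ hχu hχs g) Φ := by
  have E := relabel_doubledWeilRep_comp_retype hC hθ hθc χ hχu hχs hdV₁0 hdW₁0 hdV₂0 hdW₂0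
  have hrel : ∀ h, doubledWeilRep L e dV₂ hdV₂ hdV₂0 dW₂ hdW₂ hdW₂0 χ hχu hχs h =
      adelicMpContRelabel (Fp L) (Fin (n + n)) 1 hC (doubledWeilRep L e dV₁ hdV₁ hdV₁0 dW₁ hdW₁ hdW₁0 χ hχu hχs (θ h)) :=
    fun h => (DFunLike.congr_fun E h).symm
  exact omega_undouble_eq_of_relabel_comp_retype (hdV₁0 := hdV₁0) (hdW₁0 := hdW₁0) (hdV₂0 := hdV₂0) (hdW₂0 := hdW₂0) hC hθ hθG
    (isDoubledWeilRep_doubledWeilRep L e dV₁ hdV₁ hdV₁0 dW₁ hdW₁ hdW₁0 χ hχu hχs).proj_eq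
    (isDoubledWeilRep_doubledWeilRep L e dV₂ hdV₂ hdV₂0 dW₂ hdW₂ hdW₂0 χ hχu hχs).proj_eq hrel g Φ

end Undouble

end Literature.NumberTheory.GelbartRogawski1991.GRConstruction

end
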